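import Summits.KontsevichZagierPeriods.Zeta5Search.HypergeometricSaalschutz

/-!
# Dougall's terminating very-well-poised ₅F₄ summation via a Wilf–Zeilberger certificate

HONEST FRAMING: systematic search; no irrationality claim unless certified.

Provenance: written by planner gen-1 g4 (second half of staged `HOME/lean/HypergeometricSummation.lean`,
sha256 `d1174a317937…`), filed verbatim (plus docstrings; split at 400 lines) by typer g6.

  `Σ_{r=0}^{v} (A+2r)/A · (A)_r (B)_r (C)_r (-v)_r / (r! (1+A-B)_r (1+A-C)_r (1+A+v)_r) · (1+A-B)_v (1+A-C)_v
      = (1+A)_v (1+A-B-C)_v`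

(`dougall5F4`), via the certificate `R(v,r) = -r (r+A-B)(r+A-C) / ((v+1-r)(A+2r)(1+A-B-C+v))`
(`d5_wz_eq_zero`, `d5_wz_eq_succ`, `d5_wz_top`, `d5Sum_rec`).  With `A = c-1, B = c-a, C = -u, D = -v` this is
exactly the Burchnall–Chaundy kernel expansion `(a)_{u+v}/(c)_{u+v} = Σ_r γ_r φ_r(u) φ_r(v)` of PROOF-NOTES-g4 §9,
Step 2 (see the docstring of `dougall5F4`).
-/

open Polynomial Finset

namespace Summit.KontsevichZagierPeriods.Zeta5Search.Hypergeometric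

variable {K : Type*} [Field K] [CharZero K]

/-! ## Dougall's terminating very-well-poised `₅F₄` -/

/-- VWP summand `(A+2r) (A)_r (B)_r (C)_r (x)_r / (A r! (1+A-B)_r (1+A-C)_r (E)_r)` (`x = -v`, `E = 1 + A + v`). -/
noncomputable def d5term (A B C x E : K) (r : ℕ) : K :=
  (A + 2 * r) * ph A r * ph B r * ph C r * ph x r /
    (A * (r.factorial : K) * ph (1 + A - B) r * ph (1 + A - C) r * ph E r)

/-- WZ companion for Dougall: `g r = G(v, r+1)`. -/
noncomputable def d5wz (A B C x E : K) (r : ℕ) : K :=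
  -(ph A (r + 1) * ph B (r + 1) * ph C (r + 1) * ph (x - 1) (r + 1)) /
    (A * (1 - x) * (r.factorial : K) * ph (1 + A - B) r * ph (1 + A - C) r * ph (E + 1) r)

omit [CharZero K] in
/-- Dougall WZ equation at `r = 0`. -/
theorem d5_wz_eq_zero (A B C x E : K) (hA : A ≠ 0) (h1x : 1 - x ≠ 0) :
    (1 + A - B - x) * (1 + A - C - x) * d5term A B C (x - 1) (E + 1) 0
      - (1 + A - x) * (1 + A - B - C - x) * d5term A B C x E 0 = d5wz A B C x E 0 := by
  simp only [d5term, d5wz, ph_zero, ph_one, Nat.factorial_zero, Nat.cast_one, Nat.cast_zero, mul_zero, add_zero,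
    zero_add]
  field_simp
  ring

/-! ### The four terms of the Dougall WZ equation as multiples of a common factor

`M r = (A)_r (B)_r (C)_r (x-1)_r / (r! (1+A-B)_r (1+A-C)_r (E+1)_r)`; each lemma below is a separate
declaration so that every normalisation gets its own heartbeat budget.  The pure monomial
rearrangements are closed by cross-multiplication and `ac_rfl` (no expansion). -/

omit [CharZero K] in
set_option maxHeartbeats 800000 in
/-- `F(v+1, r+1)` (shifted parameters) as a multiple of the common factor `M r`. -/
private theorem d5_aux1 (A B C x E : K) (r : ℕ) (hA : A ≠ 0) (hfr : (r.factorial : K) ≠ 0)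
    (hr1 : (r : K) + 1 ≠ 0) (hB1 : ph (1 + A - B) r ≠ 0) (hB2 : 1 + A - B + r ≠ 0)
    (hC1 : ph (1 + A - C) r ≠ 0) (hC2 : 1 + A - C + r ≠ 0) (hE11 : ph (E + 1) r ≠ 0)
    (hE12 : E + 1 + r ≠ 0) :
    d5term A B C (x - 1) (E + 1) (r + 1)
      = (ph A r * ph B r * ph C r * ph (x - 1) r /
          ((r.factorial : K) * ph (1 + A - B) r * ph (1 + A - C) r * ph (E + 1) r))
        * ((A + 2 * (r + 1)) * (A + r) * (B + r) * (C + r) * (x - 1 + r)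
          / (A * (r + 1) * (1 + A - B + r) * (1 + A - C + r) * (E + 1 + r))) := by
  unfold d5term
  rw [ph_succ, ph_succ, ph_succ, ph_succ, ph_succ, ph_succ, ph_succ, Nat.factorial_succ]
  push_cast
  rw [div_mul_div_comm, div_eq_div_iff]
  · generalize ((r : K) + 1) = r1
    ac_rfl
  · repeat' apply mul_ne_zero
    all_goals assumption
  · repeat' apply mul_ne_zero
    all_goals assumption

omit [CharZero K] in
set_option maxHeartbeats 1600000 in
/-- `F(v, r+1)` as a multiple of the common factor `M r`. -/
private theorem d5_aux2 (A B C x E : K) (r : ℕ) (hA : A ≠ 0) (hfr : (r.factorial : K) ≠ 0)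
    (hr1 : (r : K) + 1 ≠ 0) (hB1 : ph (1 + A - B) r ≠ 0) (hB2 : 1 + A - B + r ≠ 0)
    (hC1 : ph (1 + A - C) r ≠ 0) (hC2 : 1 + A - C + r ≠ 0) (hE02 : E + r ≠ 0)
    (hE11 : ph (E + 1) r ≠ 0) (hEz : E ≠ 0) (hx1 : x - 1 ≠ 0) :
    d5term A B C x E (r + 1)
      = (ph A r * ph B r * ph C r * ph (x - 1) r /
          ((r.factorial : K) * ph (1 + A - B) r * ph (1 + A - C) r * ph (E + 1) r))
        * ((A + 2 * (r + 1)) * (A + r) * (B + r) * (C + r) * (x - 1 + r) * (x + r)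
          / (A * (r + 1) * (1 + A - B + r) * (1 + A - C + r) * (x - 1) * E)) := by
  have rel1 : ph x r = ph (x - 1) r * (x - 1 + r) / (x - 1) := by
    rw [eq_div_iff hx1]
    have := ph_shift (x - 1) r
    rw [show x - 1 + 1 = x by ring] at this
    linear_combination -this
  have relE : ph E r = E * ph (E + 1) r / (E + r) := by
    rw [eq_div_iff hE02]
    exact ph_shift E r
  unfold d5term
  rw [ph_succ, ph_succ, ph_succ, ph_succ, ph_succ, ph_succ, ph_succ, Nat.factorial_succ]
  push_cast
  rw [rel1, relE]
  field_simp

omit [CharZero K] in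
set_option maxHeartbeats 800000 in
/-- `G(v, r+2) = d5wz … (r+1)` as a multiple of the common factor `M r`. -/
private theorem d5_aux3 (A B C x E : K) (r : ℕ) (hA : A ≠ 0) (h1x : 1 - x ≠ 0)
    (hfr : (r.factorial : K) ≠ 0) (hr1 : (r : K) + 1 ≠ 0) (hB1 : ph (1 + A - B) r ≠ 0)
    (hB2 : 1 + A - B + r ≠ 0) (hC1 : ph (1 + A - C) r ≠ 0) (hC2 : 1 + A - C + r ≠ 0)
    (hE11 : ph (E + 1) r ≠ 0) (hE12 : E + 1 + r ≠ 0) :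
    d5wz A B C x E (r + 1)
      = d5wz A B C x E r * (((A + (r + 1)) * (B + (r + 1)) * (C + (r + 1)) * (x - 1 + (r + 1)))
          / ((r + 1) * (1 + A - B + r) * (1 + A - C + r) * (E + 1 + r))) := by
  unfold d5wz
  rw [ph_succ, ph_succ, ph_succ, ph_succ, ph_succ, ph_succ, ph_succ, ph_succ, ph_succ, ph_succ, ph_succ,
    Nat.factorial_succ]
  push_cast
  rw [div_mul_div_comm, div_eq_div_iff]
  · simp only [neg_mul, neg_inj]
    generalize ((r : K) + 1) = r1
    ac_rfl
  · repeat' apply mul_ne_zero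
    all_goals assumption
  · repeat' apply mul_ne_zero
    all_goals assumption

omit [CharZero K] in
set_option maxHeartbeats 800000 in
/-- `G(v, r+1) = d5wz … r` as a multiple of the common factor `M r`. -/
private theorem d5_aux4 (A B C x E : K) (r : ℕ) (hA : A ≠ 0) (h1x : 1 - x ≠ 0)
    (hfr : (r.factorial : K) ≠ 0) (hB1 : ph (1 + A - B) r ≠ 0) (hC1 : ph (1 + A - C) r ≠ 0)
    (hE11 : ph (E + 1) r ≠ 0) :
    d5wz A B C x E r
      = (ph A r * ph B r * ph C r * ph (x - 1) r /
          ((r.factorial : K) * ph (1 + A - B) r * ph (1 + A - C) r * ph (E + 1) r))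
        * (-((A + r) * (B + r) * (C + r) * (x - 1 + r)) / (A * (1 - x))) := by
  unfold d5wz
  rw [ph_succ, ph_succ, ph_succ, ph_succ]
  rw [div_mul_div_comm, div_eq_div_iff]
  · simp only [neg_mul, mul_neg, neg_inj]
    ac_rfl
  · repeat' apply mul_ne_zero
    all_goals assumption
  · repeat' apply mul_ne_zero
    all_goals assumption

omit [CharZero K] in
set_option maxHeartbeats 1600000 in
/-- The scalar identity behind the Dougall WZ certificate (well-poisedness `E = 1 + A - x`). -/
private theorem d5_key (A B C x E : K) (r : ℕ) (hwp : E = 1 + A - x) (hA : A ≠ 0) (h1x : 1 - x ≠ 0)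
    (hx1 : x - 1 ≠ 0) (hEz : E ≠ 0) (hr1 : (r : K) + 1 ≠ 0) (hB2 : 1 + A - B + r ≠ 0)
    (hC2 : 1 + A - C + r ≠ 0) (hE12 : E + 1 + r ≠ 0) :
    (1 + A - B - x) * (1 + A - C - x) * ((A + 2 * (r + 1)) * (A + r) * (B + r) * (C + r) * (x - 1 + r)
          / (A * (r + 1) * (1 + A - B + r) * (1 + A - C + r) * (E + 1 + r)))
      - (1 + A - x) * (1 + A - B - C - x) * ((A + 2 * (r + 1)) * (A + r) * (B + r) * (C + r) * (x - 1 + r) * (x + r)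
          / (A * (r + 1) * (1 + A - B + r) * (1 + A - C + r) * (x - 1) * E))
      = (-((A + r) * (B + r) * (C + r) * (x - 1 + r)) / (A * (1 - x)))
          * (((A + (r + 1)) * (B + (r + 1)) * (C + (r + 1)) * (x - 1 + (r + 1)))
            / ((r + 1) * (1 + A - B + r) * (1 + A - C + r) * (E + 1 + r)))
        - (-((A + r) * (B + r) * (C + r) * (x - 1 + r)) / (A * (1 - x))) := by
  subst hwp
  field_simp
  ring

/-- WZ equation for Dougall at `r + 1` (generic `x`; well-poised condition `E = 1 + A - x`).
All four terms are `M r` times a scalar, `M r = (A)_r (B)_r (C)_r (x-1)_r / (r! (1+A-B)_r (1+A-C)_r (E+1)_r)`;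
the identity is then a rational identity in the scalars (`d5_key`). -/
theorem d5_wz_eq_succ (A B C x E : K) (r : ℕ) (hwp : E = 1 + A - x) (hA : A ≠ 0) (h1x : 1 - x ≠ 0)
    (hB : ph (1 + A - B) (r + 1) ≠ 0) (hC : ph (1 + A - C) (r + 1) ≠ 0)
    (hE0 : ph E (r + 1) ≠ 0) (hE1 : ph (E + 1) (r + 1) ≠ 0) :
    (1 + A - B - x) * (1 + A - C - x) * d5term A B C (x - 1) (E + 1) (r + 1)
      - (1 + A - x) * (1 + A - B - C - x) * d5term A B C x E (r + 1)
      = d5wz A B C x E (r + 1) - d5wz A B C x E r := by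
  have hB' : ph (1 + A - B) r ≠ 0 ∧ 1 + A - B + r ≠ 0 := by
    rw [ph_succ] at hB; exact mul_ne_zero_iff.mp hB
  have hC' : ph (1 + A - C) r ≠ 0 ∧ 1 + A - C + r ≠ 0 := by
    rw [ph_succ] at hC; exact mul_ne_zero_iff.mp hC
  have hE0' : ph E r ≠ 0 ∧ E + r ≠ 0 := by
    rw [ph_succ] at hE0; exact mul_ne_zero_iff.mp hE0
  have hE1' : ph (E + 1) r ≠ 0 ∧ E + 1 + r ≠ 0 := by
    rw [ph_succ] at hE1; exact mul_ne_zero_iff.mp hE1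
  obtain ⟨hB1, hB2⟩ := hB'
  obtain ⟨hC1, hC2⟩ := hC'
  obtain ⟨-, hE02⟩ := hE0'
  obtain ⟨hE11, hE12⟩ := hE1'
  have hEz : E ≠ 0 := by
    intro h; apply hE0; rw [ph_succ_left, h, zero_mul]
  have hfr : (r.factorial : K) ≠ 0 := by exact_mod_cast r.factorial_ne_zero
  have hr1 : (r : K) + 1 ≠ 0 := by exact_mod_cast r.succ_ne_zero
  have hx1 : x - 1 ≠ 0 := by intro h; apply h1x; linear_combination -h
  rw [d5_aux1 A B C x E r hA hfr hr1 hB1 hB2 hC1 hC2 hE11 hE12,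
    d5_aux2 A B C x E r hA hfr hr1 hB1 hB2 hC1 hC2 hE02 hE11 hEz hx1,
    d5_aux3 A B C x E r hA h1x hfr hr1 hB1 hB2 hC1 hC2 hE11 hE12,
    d5_aux4 A B C x E r hA h1x hfr hB1 hC1 hE11]
  linear_combination (ph A r * ph B r * ph C r * ph (x - 1) r /
      ((r.factorial : K) * ph (1 + A - B) r * ph (1 + A - C) r * ph (E + 1) r))
    * d5_key A B C x E r hwp hA h1x hx1 hEz hr1 hB2 hC2 hE12

/-- Dougall WZ boundary at the top (`x = -v`, `r = v + 1`). -/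
theorem d5_wz_top (A B C E : K) (v : ℕ) (hwp : E = 1 + A + v) (hA : A ≠ 0)
    (hB : ph (1 + A - B) (v + 1) ≠ 0) (hC : ph (1 + A - C) (v + 1) ≠ 0) (hE1 : ph (E + 1) (v + 1) ≠ 0) :
    (1 + A - B + v) * (1 + A - C + v) * d5term A B C (-(v : K) - 1) (E + 1) (v + 1)
      + d5wz A B C (-(v : K)) E v = 0 := by
  have hB' : ph (1 + A - B) v ≠ 0 ∧ 1 + A - B + v ≠ 0 := by
    rw [ph_succ] at hB; exact mul_ne_zero_iff.mp hB
  have hC' : ph (1 + A - C) v ≠ 0 ∧ 1 + A - C + v ≠ 0 := by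
    rw [ph_succ] at hC; exact mul_ne_zero_iff.mp hC
  have hE1' : ph (E + 1) v ≠ 0 ∧ E + 1 + v ≠ 0 := by
    rw [ph_succ] at hE1; exact mul_ne_zero_iff.mp hE1
  obtain ⟨hB1, hB2⟩ := hB'
  obtain ⟨hC1, hC2⟩ := hC'
  obtain ⟨hE11, hE12⟩ := hE1'
  have hfv : (v.factorial : K) ≠ 0 := by exact_mod_cast v.factorial_ne_zero
  have hv1 : (v : K) + 1 ≠ 0 := by exact_mod_cast v.succ_ne_zero
  have hv1' : (1 : K) + v ≠ 0 := by rw [add_comm]; exact hv1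
  have hv1'' : (1 : K) - (-(v : K)) ≠ 0 := by rw [sub_neg_eq_add]; exact hv1'
  simp only [d5term, d5wz]
  simp only [ph_succ, Nat.factorial_succ, Nat.cast_mul, Nat.cast_add, Nat.cast_one]
  subst hwp
  field_simp
  ring

/-- Dougall's terminating VWP sum `₅F₄(A, 1+A/2, B, C, -v; A/2, 1+A-B, 1+A-C, 1+A+v; 1)`. -/
noncomputable def d5Sum (A B C : K) (v : ℕ) : K :=
  ∑ r ∈ range (v + 1), d5term A B C (-(v : K)) (1 + A + v) r

/-- First-order recurrence in `v` for the Dougall sum (sum the WZ equation over `r`, telescope). -/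
theorem d5Sum_rec (A B C : K) (v : ℕ) (hA : A ≠ 0)
    (hB : ∀ k ≤ v + 1, ph (1 + A - B) k ≠ 0) (hC : ∀ k ≤ v + 1, ph (1 + A - C) k ≠ 0)
    (hE0 : ∀ k ≤ v, ph (1 + A + v) k ≠ 0) (hE1 : ∀ k ≤ v + 1, ph (1 + A + v + 1) k ≠ 0) :
    (1 + A - B + v) * (1 + A - C + v) * d5Sum A B C (v + 1)
      = (1 + A + v) * (1 + A - B - C + v) * d5Sum A B C v := by
  set E : K := 1 + A + v with hE_def
  have hwp : E = 1 + A - (-(v : K)) := by rw [hE_def]; ring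
  have h1x : (1 : K) - (-(v : K)) ≠ 0 := by
    have hv1 : (v : K) + 1 ≠ 0 := by exact_mod_cast v.succ_ne_zero
    rw [sub_neg_eq_add, add_comm]; exact hv1
  have eS : d5Sum A B C (v + 1) = (∑ r ∈ range (v + 1), d5term A B C (-(v : K) - 1) (E + 1) r)
      + d5term A B C (-(v : K) - 1) (E + 1) (v + 1) := by
    unfold d5Sum
    have e1 : (-((v + 1 : ℕ) : K)) = -(v : K) - 1 := by push_cast; ring
    have e2 : (1 + A + ((v + 1 : ℕ) : K)) = E + 1 := by rw [hE_def]; push_cast; ring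
    rw [e1, e2, Finset.sum_range_succ]
  have H1 : ∑ r ∈ range (v + 1), ((1 + A - B - (-(v : K))) * (1 + A - C - (-(v : K)))
        * d5term A B C (-(v : K) - 1) (E + 1) r
      - (1 + A - (-(v : K))) * (1 + A - B - C - (-(v : K))) * d5term A B C (-(v : K)) E r)
      = d5wz A B C (-(v : K)) E v := by
    rw [Finset.sum_range_succ']
    have h0 := d5_wz_eq_zero A B C (-(v : K)) E hA h1x
    have hs : ∀ r ∈ range v, (1 + A - B - (-(v : K))) * (1 + A - C - (-(v : K)))
          * d5term A B C (-(v : K) - 1) (E + 1) (r + 1)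
        - (1 + A - (-(v : K))) * (1 + A - B - C - (-(v : K))) * d5term A B C (-(v : K)) E (r + 1)
        = d5wz A B C (-(v : K)) E (r + 1) - d5wz A B C (-(v : K)) E r := by
      intro r hr
      have hr' : r + 1 ≤ v := Nat.succ_le_of_lt (mem_range.mp hr)
      exact d5_wz_eq_succ A B C (-(v : K)) E r hwp hA h1x (hB (r + 1) (by omega)) (hC (r + 1) (by omega))
        (hE0 (r + 1) hr') (hE1 (r + 1) (by omega))
    rw [Finset.sum_congr rfl hs, Finset.sum_range_sub, h0]
    ring
  have H2 := d5_wz_top A B C E v hE_def hA (hB (v + 1) le_rfl) (hC (v + 1) le_rfl) (hE1 (v + 1) le_rfl)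
  have H1' : (1 + A - B + v) * (1 + A - C + v) * (∑ r ∈ range (v + 1), d5term A B C (-(v : K) - 1) (E + 1) r)
      - (1 + A + v) * (1 + A - B - C + v) * d5Sum A B C v = d5wz A B C (-(v : K)) E v := by
    rw [← H1, Finset.sum_sub_distrib, ← Finset.mul_sum, ← Finset.mul_sum]
    unfold d5Sum
    ring
  rw [eS]
  linear_combination H1' + H2

/-- **Dougall's terminating very-well-poised `₅F₄` summation**, denominators cleared:
`₅F₄(A, 1+A/2, B, C, -v; A/2, 1+A-B, 1+A-C, 1+A+v; 1) · (1+A-B)_v (1+A-C)_v = (1+A)_v (1+A-B-C)_v`.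
With `A = c - 1`, `B = c - a`, `C = -u` (and using `(c)_r (c+r)_r / (c+r-1)_r = (c-1)_r (c-1+2r)/(c-1)`)
this is the Burchnall–Chaundy kernel expansion `(a)_{u+v}/(c)_{u+v} = Σ_r γ_r φ_r(u) φ_r(v)`,
`φ_r(u) = (a)_u (-u)_r/(c+r)_u`, `γ_r = (c-a)_r (c+r)_r/(r! (a)_r (c)_r (c+r-1)_r)` (PROOF-NOTES-g4 §9, Step 2). -/
theorem dougall5F4 (A B C : K) (v : ℕ) (hA : A ≠ 0)
    (hB : ∀ k ≤ v, ph (1 + A - B) k ≠ 0) (hC : ∀ k ≤ v, ph (1 + A - C) k ≠ 0)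
    (hE : ∀ j ≤ v, ∀ k ≤ j, ph (1 + A + j) k ≠ 0) :
    d5Sum A B C v * (ph (1 + A - B) v * ph (1 + A - C) v) = ph (1 + A) v * ph (1 + A - B - C) v := by
  induction v with
  | zero =>
    simp [d5Sum, d5term, ph_zero, hA]
  | succ v ih =>
    have ih' := ih (fun k hk => hB k (by omega)) (fun k hk => hC k (by omega))
      (fun j hj k hk => hE j (by omega) k hk)
    have hE1 : ∀ k ≤ v + 1, ph (1 + A + v + 1) k ≠ 0 := by
      intro k hk
      have h := hE (v + 1) le_rfl k hk
      have e : (1 + A + ((v + 1 : ℕ) : K)) = 1 + A + v + 1 := by push_cast; ring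
      rwa [e] at h
    have REC := d5Sum_rec A B C v hA hB hC (fun k hk => hE v (by omega) k hk) hE1
    simp only [ph_succ]
    linear_combination (ph (1 + A - B) v * ph (1 + A - C) v) * REC
      + ((1 + A + v) * (1 + A - B - C + v)) * ih'

end Summit.KontsevichZagierPeriods.Zeta5Search.Hypergeometric
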